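import Summits.QuantumFields.YangMills.Theorems.BalabanUVNodesN08ReMassedACThm2
import Summits.QuantumFields.YangMills.Theorems.BalabanUVNodesN08SlotOfRecordFromAlphaACMassBound

/-!
# BalabanUVNodes ∕ N08 — THE RE-MASSED AC TOWER, III-a: the large-field row B25 POINTWISE for a capped re-massing, (46), the constants, and the WHOLE analytic bundle
# `UVStability3D.AnalyticLeaves` of the end theorem at the re-massed tower from the (α)-AC rows

Track A, DAG node N08 = T. Bałaban, CMP **102** (1985) 255–275 [Balaban1985UV3]: Thm 1 p. 257 (bounds (5)), Thm 2 p. 272, (41) p. 266, (46) p. 267, (65) p. 273, (67)–(71) pp. 273–274;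
the averaging (2) = [Balaban1985Averaging] (15) p. 19.  Cell `pub-ymgap`, width seat `pub-ymgap-dag-n08-w1` (g4), W-SEAT-START-LIST §n08 item 1 successor piece (o15) = file 21a;
`--supports` K1⁷ `StabilityBAtRecordR13SepCoPH` (helper).  Fourth of the «RE-MASSED AC TOWER» files (I-a normal forms + generic C1∕C2; I-b C1∕C2 re-massed; II the mass-free leaves +
Theorem 2; this file; III-b the slot).

WHAT THIS FILE PROVES (kernel; theorems only, 0 def; nothing of the paper asserted).  For `B′ = { X.toTowerBase 𝔠.lane.carrier with W := W′ }` (hypothesis `hB′`):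
* §1 ★★ `lf_reMassed` — ROW B25 POINTWISE at the re-massed tower with the family constant `d + c_m`, from `RunAlphaAC`'s rows `hLF67`∕`h68` and the POINTWISE cap
  `W′_k(h,U) ≤ e^{c_m|T₁^{(k)}|}` (`1 ≤ k ≤ K`) — file 15 §1 `lf_towerAC3_of_massBound` (generic in the AC input) at the re-massed input: the cap is now a property of the CHOSEN
  version, not a hypothesis on print's.
* §2 ★ `bound46_reMassed` — (46) at the re-massed tower: file 14's `bound46_towerOfAC_of_alphaAC` (std tower) transported along I-a's normal forms (the interaction sum, `M₁`,
  `g`, `b₀`, `p₀`, `|Λ_k|` read no mass); `usesConsts_reMassed` — the re-massed tower USES the family constants (`rfl`s).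
* §3 ★★★ `nonempty_analyticLeaves_reMassed` — **THE WHOLE ANALYTIC BUNDLE `UVStability3D.AnalyticLeaves C′ S T′` at the re-massed tower `T′`, `C′ = {𝔠.lane.consts with d := d + c_m}`,
  from `RunAlphaAC 𝔊 𝔠 X 𝔖 𝔄` on the `≤`-family + the five `W′`-hypotheses (`hae` a.e. agreement, `hdom` domination, `hWm` measurability, `hmt` floor, `hcap` cap)** — step leaves
  from II (pieces pinned), (1)₀, no interaction at 0, B15, B20, B21, B25, the piece equations.

GENERICITY (located): everything here (and in I-a, I-b, II) is stated for ANY gauge group `G` with a `GroupModel`, ANY AC external inputs `X` (any averaging with `AvgAC`) and ANY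
expansion data — so every consumer of the lane's `Thm2AC` (e.g. the T³ socket `AlphaInputsT3AC` at `blockAvg ℰp`) obtains Theorem 1's analytic bundle under a pointwise-capped
re-massing, and (with III-b's choice `W′ = min (massRecAC) (e^{c_k})`) under a `dU`-a.e. extensive mass bound; only III-b §2–§3 specialise to `SU(N)` ∕ print's averaging.

HONEST FRAMING: count-neutral helper; the (α)-AC rows and the `W′`-hypotheses are HYPOTHESES; III-b discharges the `W′`-hypotheses from the a.e. mass bound by CHOOSING
`W′ = min (massRecAC) (e^{c_k})`; N08 NOT discharged; one finite 𝕋⁴ programme at fixed ε, Bałaban AS PRINTED — R4 closes the conditional finite-𝕋⁴ rung `BalabanLadder.UV` only; the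
Yang–Mills mass gap (Clay) is NOT proved by any of this; nothing continuum ∕ ℝ⁴ ∕ OS.  No `sorry`, standard axioms.
-/

noncomputable section

open MeasureTheory Metric

namespace Summit.QuantumFields.YangMills.BalabanUVNodes.N08ReMassedACLeaves

open scoped Matrix.Norms.L2Operator
open Literature.MathematicalPhysics.QuantumFieldTheory.Balaban1983to89
open Literature.MathematicalPhysics.QuantumFieldTheory.Balaban1983to89.B10 (TowerRun pFun)
open Literature.MathematicalPhysics.QuantumFieldTheory.Balaban1983to89.B10SectAGathering (StepLeaves)
open Literature.MathematicalPhysics.QuantumFieldTheory.Balaban1985CMP102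
open Literature.MathematicalPhysics.QuantumFieldTheory.Balaban1985CMP102.Setting
open Literature.MathematicalPhysics.QuantumFieldTheory.Balaban1985CMP102.SectB (TowerObjects)
open Summit.QuantumFields.Balaban3D
open Summit.QuantumFields.Balaban3D.Carriers
open Summit.QuantumFields.Balaban3D.Proofs
open Summit.QuantumFields.Balaban3D.Proofs.ScalesArithmetic
open Summit.QuantumFields.Balaban3D.Proofs.Constants (consts3_d_eq_log)
open Summit.QuantumFields.Balaban3D.Proofs.FamilyLE (thresholds_of_le)
open Summit.QuantumFields.Balaban3D.Proofs.Family (prov_hb₁ prov_hb₂)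
open Summit.QuantumFields.Balaban3D.Proofs.GroupModelLieC (lieC)
open Summit.QuantumFields.Balaban3D.Proofs.TowerAC
open Summit.QuantumFields.Balaban3D.Proofs.SeriesAC
open Summit.QuantumFields.Balaban3D.Proofs.StandardAC
open Summit.QuantumFields.Balaban3D.Proofs.InputsAC
open Summit.QuantumFields.Balaban3D.Proofs.MassesAC (massRecAC)
open Summit.QuantumFields.Balaban3D.Proofs.AlphaAC (AlphaDataAC StepAlphaAC RunAlphaAC)
open Summit.QuantumFields.Balaban3D.Proofs.Thresholds (gamma71L)
open Summit.QuantumFields.Balaban3D.Proofs.LiftBridge (liftCfg)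
open Summit.QuantumFields.Balaban3D.Proofs.Run3SmallFactors (codeZ)
open Summit.QuantumFields.YangMills.BalabanUVNodes.N08SlotOfRecordFromAlphaAC (bound46_towerOfAC_of_alphaAC bound25_vac_of_alphaAC)
open Summit.QuantumFields.YangMills.BalabanUVNodes.N08SlotOfRecordFromAlphaACMassBound (lf_towerAC3_of_massBound)
open Summit.QuantumFields.YangMills.BalabanUVNodes.N08SeriesACStepBounds
open Summit.QuantumFields.YangMills.BalabanUVNodes.N08ReMassedACStepBounds
open Summit.QuantumFields.YangMills.BalabanUVNodes.N08ReMassedACThm2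
open B7Prop1Explicit (hol plaqWord)
open B7Prop1Local (pdevOn loK plaqHiK)
open B7Prop2Explicit (avgIter)
open B10LargeField (xlog)

variable {L : ℕ} {S : Scales L} {G : Type} [GaugeGroup G] [MeasurableSpace G] [HaarData G]
  {𝔊 : GroupModel G} {𝔠 : Primitives.AlphaConsts L 𝔊.N} {X : ExternalInputsAC S G}
  {𝔖 : ∀ k, StepSeries S G ↥(lieC 𝔊) (nblkOf S 𝔠.lane.carrier k) k} {𝔄 : AlphaDataAC 𝔊 𝔠 X 𝔖}
  (hfam : S.g ^ 2 * S.ε₀ ≤ (min 𝔠.gamma0 1) ^ 2)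
  (W' : HistWeightsAC S.P G) (B' : TowerBaseAC S G) (hB' : B' = { X.toTowerBase 𝔠.lane.carrier with W := W' })
  (hae : ∀ j, j ≤ S.K → ∀ h : Hist S.P j, W'.mass j h =ᵐ[fieldMeasure S.P j G]
    massRecAC 𝔠.lane.carrier.M₁ (rcolOf S 𝔠.lane.carrier) (eps1Of S 𝔠.lane.carrier) (epsSOf S 𝔠.lane.carrier) X.av j h)
  (hdom : ∀ (j : ℕ) (h : Hist S.P j) (U : GaugeField S.P j G),
    W'.mass j h U ≤ massRecAC 𝔠.lane.carrier.M₁ (rcolOf S 𝔠.lane.carrier) (eps1Of S 𝔠.lane.carrier) (epsSOf S 𝔠.lane.carrier) X.av j h U)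
  (hWm : ∀ (j : ℕ) (h : Hist S.P j), Measurable (W'.mass j h)) (hmt : ∀ (j : ℕ) (U : GaugeField S.P j G), 1 ≤ W'.mass j (Hist.triv S.P j) U)
  {cm : ℝ} (hcm : 0 ≤ cm) (hcap : ∀ k, 1 ≤ k → k ≤ S.K → ∀ (h : Hist S.P k) (U : GaugeField S.P k G), W'.mass k h U ≤ Real.exp (cm * S.sites k))

/-! ## §1 Row B25 POINTWISE at the re-massed tower under the pointwise cap -/

include hfam hB' hdom hcm hcap in
/-- ★★ **ROW B25 POINTWISE AT THE RE-MASSED TOWER** from `RunAlphaAC`'s rows `hLF67`∕`h68` (they read `X.UkH` = the re-massed input's composite minimisers) and the cap on `W′`: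
file 15 §1 at the re-massed input, every lane-side hypothesis discharged as in file 15 §2. [cite: Balaban1985UV3, pp.273–274 + (67)–(68) p.273 + (39)–(41) p.266 + (7) p.257] -/
theorem lf_reMassed (R : RunAlphaAC 𝔊 𝔠 X 𝔖 𝔄) :
    ∀ k, k ≤ (B'.withSeriesAC 𝔖 (piecesParamsOf S 𝔠.lane.carrier)).tower3.toTowerRun.K →
      ∀ U : (B'.withSeriesAC 𝔖 (piecesParamsOf S 𝔠.lane.carrier)).tower3.toTowerRun.Cfg k,
      (B'.withSeriesAC 𝔖 (piecesParamsOf S 𝔠.lane.carrier)).tower3.toTowerRun.LF k U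
          (fun h => -((B'.withSeriesAC 𝔖 (piecesParamsOf S 𝔠.lane.carrier)).tower3.toTowerRun.mainT k h U)
            + (B'.withSeriesAC 𝔖 (piecesParamsOf S 𝔠.lane.carrier)).tower3.toTowerRun.Zterm k h)
        ≤ Real.exp ((𝔠.lane.consts.d + cm) * (B'.withSeriesAC 𝔖 (piecesParamsOf S 𝔠.lane.carrier)).tower3.toTowerRun.sites k) := by
  subst hB'
  have hr₀ : 0 ≤ 𝔠.lane.carrier.r₀ := le_trans zero_le_one 𝔠.one_le_r₀
  have hCz : 0 ≤ 𝔠.lane.carrier.Cz + 𝔠.lane.carrier.Cv := add_nonneg 𝔠.Cz_nonneg 𝔠.Cv_nonneg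
  have hc₁ : 0 ≤ 𝔠.lane.carrier.c₁ := by show (0 : ℝ) ≤ 3; norm_num
  have hA : 0 ≤ (𝔠.lane.carrier.Cz + 𝔠.lane.carrier.Cv) + 𝔠.lane.carrier.C₅ + 𝔠.lane.carrier.C₆ +
      (|𝔠.lane.carrier.logσ₀| + 𝔠.lane.carrier.dg) * 𝔠.lane.carrier.c₁ := by
    have := 𝔠.lane.carrier.dg_nonneg
    have := abs_nonneg 𝔠.lane.carrier.logσ₀
    have h5 : 0 ≤ 𝔠.lane.carrier.C₅ := 𝔠.C₅_nonneg
    have h6 : 0 ≤ 𝔠.lane.carrier.C₆ := 𝔠.C₆_nonneg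
    positivity
  have hρ : (0 : ℝ) ≤ (𝔠.lane.carrier.R₁ + 1) * 𝔠.lane.carrier.M₁ := by
    have : 0 ≤ 𝔠.lane.carrier.R₁ := 𝔠.R₁_nonneg
    positivity
  exact lf_towerAC3_of_massBound 𝔊 𝔠.lane.consts (consts3_d_eq_log 𝔠.lane.F 𝔠.lane.sc) rfl S.hL.2
    (({ X.toTowerBase 𝔠.lane.carrier with W := W' } : TowerBaseAC S G).withSeriesAC 𝔖 (piecesParamsOf S 𝔠.lane.carrier)) (gs := 1) (ε := S.g0sq)
    (fun k hk => by exact_mod_cast sites_eq_card S k (by omega))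
    (fun k h U hh => reMassed_mass_eq_zero_of_not_admissible W' hdom k h U hh)
    hcm hcap (g0sq_pos S) 𝔠.C68_pos 𝔠.lane.F.b₀_pos 𝔠.lane.F.p₀_pos
    (fun j => by rw [show 𝔠.lane.consts.g = 1 from rfl, show 𝔠.lane.consts.L = (L : ℝ) from rfl]; exact gk_eq_gRun_norm S j)
    (fun j hj => (thresholds_of_le hfam j hj.le).2.2.2.1) R.hLF67 R.h68 𝔠.lane.F.M₁_pos
    (LargeFieldStd.rcolOf_antitone 𝔠.lane.carrier 𝔠.R₁_nonneg hr₀) hρ hr₀ (LargeFieldStd.rcolOf_le 𝔠.lane.carrier 𝔠.R₁_nonneg hr₀)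
    (LargeFieldStd.zcoefOf_nonneg 𝔠.lane.carrier hCz 𝔠.C₅_nonneg 𝔠.C₆_nonneg hc₁)
    (LargeFieldStd.zcoefOf_le 𝔠.lane.carrier hCz 𝔠.C₅_nonneg 𝔠.C₆_nonneg hc₁) hA
    (fun j hj => ⟨gk_pos S j, gk_le_one S S.gK_le_one j hj⟩) le_rfl 𝔠.prov_r₀p₀ (prov_hb₁ 𝔠 𝔊.N_pos) (prov_hb₂ 𝔠 𝔊.N_pos)

/-! ## §2 (46) at the re-massed tower and the family constants -/

section InputNormalForms

variable (𝔎 : Inputs.LaneConsts L) {V : Type} [NormedAddCommGroup V] [NormedSpace ℂ V] (Y : ExternalInputsAC S G)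
  (𝔗 : ∀ k, StepSeries S G V (nblkOf S 𝔎.carrier k) k) (W₀ : HistWeightsAC S.P G)

/-- The lane's AC input: interaction sum, `M₁`, `Rcol`, `b₀`, `p₀` in normal form (`rfl`). [folklore] -/
theorem inputOfAC_Pint : (inputOfAC 𝔎 Y 𝔗).Pint = pintOfSeries 𝔎.carrier.M₁ (rcolOf S 𝔎.carrier) 𝔗 := rfl

/-- see `inputOfAC_Pint`. [folklore] -/
theorem inputOfAC_M₁ : (inputOfAC 𝔎 Y 𝔗).M₁ = 𝔎.carrier.M₁ := rfl

/-- see `inputOfAC_Pint`. [folklore] -/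
theorem inputOfAC_Rcol : (inputOfAC 𝔎 Y 𝔗).Rcol = rcolOf S 𝔎.carrier := rfl

/-- see `inputOfAC_Pint`. [folklore] -/
theorem inputOfAC_b₀ : (inputOfAC 𝔎 Y 𝔗).b₀ = 𝔎.carrier.b₀ := rfl

/-- see `inputOfAC_Pint`. [folklore] -/
theorem inputOfAC_p₀ : (inputOfAC 𝔎 Y 𝔗).p₀ = 𝔎.carrier.p₀ := rfl

/-- The re-massed base: `M₁`, `Rcol`, `b₀`, `p₀` are the carrier constants' (`rfl`). [folklore] -/
theorem reMassed_M₁ : ({ Y.toTowerBase 𝔎.carrier with W := W₀ } : TowerBaseAC S G).M₁ = 𝔎.carrier.M₁ := rfl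

/-- see `reMassed_M₁`. [folklore] -/
theorem reMassed_Rcol : ({ Y.toTowerBase 𝔎.carrier with W := W₀ } : TowerBaseAC S G).Rcol = rcolOf S 𝔎.carrier := rfl

/-- see `reMassed_M₁`. [folklore] -/
theorem reMassed_b₀ : ({ Y.toTowerBase 𝔎.carrier with W := W₀ } : TowerBaseAC S G).b₀ = 𝔎.carrier.b₀ := rfl

/-- see `reMassed_M₁`. [folklore] -/
theorem reMassed_p₀ : ({ Y.toTowerBase 𝔎.carrier with W := W₀ } : TowerBaseAC S G).p₀ = 𝔎.carrier.p₀ := rfl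

end InputNormalForms

omit hB' in
include hfam in
/-- **(46) IN NORMAL FORM** from the (α)-AC rows (file 14's `bound46_towerOfAC_of_alphaAC` at the std tower with its tower-level terms unfolded to the interaction sum
`pintOfSeries`, the carrier's `M₁`, `b₀`, `p₀`, `Rcol`, the running coupling and `min |Ω_k^{(k)}(h)| |T₁^{(k)}|`). [cite: Balaban1985UV3, (44)–(46) p.267] -/
theorem bound46_normal_of_alphaAC (R : RunAlphaAC 𝔊 𝔠 X 𝔖 𝔄) :
    ∀ k, 1 ≤ k → k ≤ S.K → ∀ (h : Hist S.P k) (U : GaugeField S.P k G),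
      |pintOfSeries 𝔠.lane.carrier.M₁ (rcolOf S 𝔠.lane.carrier) 𝔖 k h U| ≤
        𝔠.lane.consts.C46 * ((𝔠.lane.carrier.M₁ : ℕ) : ℝ) ^ 3 * (S.gk (k - 1) ^ 2 * pFun 𝔠.lane.carrier.b₀ 𝔠.lane.carrier.p₀ (S.gk (k - 1)) ^ 2) *
          min ((LamVol 𝔠.lane.carrier.M₁ (rcolOf S 𝔠.lane.carrier) k h : ℕ) : ℝ) (S.sites k) := by
  intro k hk1 hkK h U
  have h46 := bound46_towerOfAC_of_alphaAC hfam R k hk1 hkK h U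
  simp only [tower3_Pint, tower3_M₁, tower3_g, tower3_b₀, tower3_p₀, tower3_Λvol, inputOfAC_Pint, inputOfAC_M₁, inputOfAC_Rcol, inputOfAC_b₀, inputOfAC_p₀] at h46
  exact h46

include hfam hB' in
/-- ★ **(46) AT THE RE-MASSED TOWER** in the shape of `UVStability3D.AnalyticLeaves.bound46` — the normal form read back at the re-massed tower's projections (one-sided
definitional unfolding only; the interaction sum, `M₁`, `g`, `b₀`, `p₀`, `|Λ_k|` read no mass). [cite: Balaban1985UV3, (44)–(46) p.267] -/
theorem bound46_reMassed (R : RunAlphaAC 𝔊 𝔠 X 𝔖 𝔄) :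
    ∀ k, 1 ≤ k → k ≤ (B'.withSeriesAC 𝔖 (piecesParamsOf S 𝔠.lane.carrier)).tower3.toTowerRun.K →
      ∀ (h : (B'.withSeriesAC 𝔖 (piecesParamsOf S 𝔠.lane.carrier)).tower3.toTowerRun.Hist k)
        (U : (B'.withSeriesAC 𝔖 (piecesParamsOf S 𝔠.lane.carrier)).tower3.toTowerRun.Cfg k),
      |(B'.withSeriesAC 𝔖 (piecesParamsOf S 𝔠.lane.carrier)).tower3.toTowerRun.Pint k h U| ≤
        𝔠.lane.consts.C46 * (B'.withSeriesAC 𝔖 (piecesParamsOf S 𝔠.lane.carrier)).tower3.toTowerRun.M₁ ^ 3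
        * (((B'.withSeriesAC 𝔖 (piecesParamsOf S 𝔠.lane.carrier)).tower3.toTowerRun.g (k - 1)) ^ 2
          * (pFun (B'.withSeriesAC 𝔖 (piecesParamsOf S 𝔠.lane.carrier)).tower3.toTowerRun.b₀ (B'.withSeriesAC 𝔖 (piecesParamsOf S 𝔠.lane.carrier)).tower3.toTowerRun.p₀
            ((B'.withSeriesAC 𝔖 (piecesParamsOf S 𝔠.lane.carrier)).tower3.toTowerRun.g (k - 1))) ^ 2)
        * (B'.withSeriesAC 𝔖 (piecesParamsOf S 𝔠.lane.carrier)).tower3.toTowerRun.Λvol k h := by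
  subst hB'
  exact fun k hk1 hkK h U => bound46_normal_of_alphaAC hfam R k hk1 hkK h U

omit 𝔄 in
include hB' in
/-- **THE RE-MASSED TOWER USES THE FAMILY CONSTANTS** (`EndTheorem.UsesConsts`, every field `rfl` but `Λvol ≥ 0`; as file 14's `usesConsts_inputOfAC`). [folklore] -/
theorem usesConsts_reMassed (slot : ℕ → Prop) : EndTheorem.UsesConsts 𝔠.lane.consts ((B'.withSeriesAC 𝔖 (piecesParamsOf S 𝔠.lane.carrier)).towerWith slot) := by
  subst hB'
  exact
    { M₁_eq := rfl
      b₀_eq := rfl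
      p₀_eq := rfl
      κ₀_eq := rfl
      rcoef_eq := fun j => by
        show Carriers.rcoefOf S 𝔠.lane.carrier j = _
        exact Inputs.rcoefOf_carrier 𝔠.lane S j
      Λvol_nonneg := fun k _ => le_min (Nat.cast_nonneg _) (sites_nonneg S k) }

/-! ## §3 The whole analytic bundle at the re-massed tower -/

include hfam hB' hae hdom hWm hmt hcm hcap in
open Classical in
/-- ★★★ **`UVStability3D.AnalyticLeaves C′ S T′` AT THE RE-MASSED TOWER `T′`, `C′ = {𝔠.lane.consts with d := d + c_m}`, FROM THE (α)-AC ROWS AND THE FIVE `W′`-HYPOTHESES**: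
step leaves from II (`exists_stepLeaves_reMassed`, pieces pinned — so the piece equations and B20∕B21 are read off the re-massed pinned pieces), (1)₀ (`step0_reMassed`), no
interaction at level 0 (`noInteraction0_seriesAC`), B15 (`bound46_reMassed`), B20 (`logZT_le_reMassed`), B21 (`LeavesCumAC.pprT_le_series_stdAC` at `B′` with file 14's (25) at
the chart centre), B25 POINTWISE (`lf_reMassed`).  `C′` differs from the record's constants only in `d`. [cite: Balaban1985UV3, pp.256–274 (the leaves) + (46) p.267 + (65) p.273 + pp.273–274] -/
theorem nonempty_analyticLeaves_reMassed (R : RunAlphaAC 𝔊 𝔠 X 𝔖 𝔄) :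
    Nonempty (UVStability3D.AnalyticLeaves { 𝔠.lane.consts with d := 𝔠.lane.consts.d + cm, d_nonneg := add_nonneg 𝔠.lane.consts.d_nonneg hcm } S
      (B'.withSeriesAC 𝔖 (piecesParamsOf S 𝔠.lane.carrier)).tower3.toTowerRun) := by
  have hsteps := fun k (hk : k + 1 ≤ S.K) => exists_stepLeaves_reMassed hfam W' B' hB' hae hdom hWm hmt hk (R.steps k hk)
  have hlf := lf_reMassed hfam W' B' hB' hdom hcm hcap R
  have h46 := bound46_reMassed hfam W' B' hB' R
  have hZT := fun k (hk : k + 1 ≤ S.K) => logZT_le_reMassed W' B' hB' (R.steps k hk)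
  have h0 := step0_reMassed W' B' hB' (𝔖 := 𝔖)
  subst hB'
  refine ⟨{ step0 := h0
            noInt0 := TowerBaseAC.noInteraction0_seriesAC _ 𝔖 _
            steps := fun k hk => (hsteps k hk).choose
            bound46 := h46
            logZT_le := fun k hk => ?_
            PprT_le := fun k hk => ?_
            lf := hlf
            starT_eq := fun k hk => ?_
            logσ₀_le := fun k hk => ?_
            dg_le := fun k hk => ?_
            rem_eq := fun k hk => ?_ }⟩
  · rw [(hsteps k hk).choose_spec]; exact hZT k hk
  · have hk' : k + 1 ≤ S.K := hk
    rw [(hsteps k hk).choose_spec]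
    exact LeavesCumAC.pprT_le_series_stdAC _ 𝔖 (piecesParamsOf S 𝔠.lane.carrier) k (by linarith [𝔠.kappa_ge]) 𝔠.C25_nonneg (by omega) (fun _ => 1)
      (bound25_vac_of_alphaAC hfam k hk' (R.steps k hk')) (Inputs.nblk_cube_le_sites 𝔠.lane k (by omega))
  · rw [(hsteps k hk).choose_spec]; rfl
  · rw [(hsteps k hk).choose_spec]; exact le_rfl
  · rw [(hsteps k hk).choose_spec]; exact le_rfl
  · rw [(hsteps k hk).choose_spec]; rfl

end Summit.QuantumFields.YangMills.BalabanUVNodes.N08ReMassedACLeaves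

end
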